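import Summits.ValiantsHypothesis.ValiantsHypothesis.Theorems.MonotoneRestorationOrbitRestorationQPUniformForm
import Summits.ValiantsHypothesis.ValiantsHypothesis.Theorems.MonotoneRestorationOrbitRestorationQPLogDepthIff
import HarnessLib

/-!
# The crux `OrbitRestorationQP` and every rung of its ladder are equivalent to their UNIFORM LEVELWISE forms

Crux item stmt-ValiantsHypothesis-18293, line `depth_three_rung`; namespace
`Summit.ValiantsHypothesis.ValiantsHypothesis.Theorems.OrbitRestorationQPDepthThreeRung.UniformForm`.

`…UniformForm.lean` traded the family quantifier of the rung A_∞ for one constant per exponent.  The argument only uses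
that the class is LEVELWISE, monotone in its exponent and contains the constant `1`; this file runs it for the whole
graded family `RestorationOn 𝒞` of the line's vocabulary and instantiates it:

* `restorationOn_iff_uniform` — for any class `𝒞 n c q` monotone in `c` and containing `1` at some exponent:
  `RestorationOn 𝒞 ⟺ ∀ c ∃ c' ∀ n ∀ q, (q matrix-symmetric at level n ∧ 𝒞 n c q) → QPOrbitRestorable c' n q`;
* `orbitRestorationQP_iff_uniform` — **THE CRUX ITSELF**: `OrbitRestorationQP ⟺ ∀ c ∃ c' ∀ n ∀ q, (q matrix-symmetric,
  deg q ≤ n^c + c, complexity q ≤ n^c + c) → QPOrbitRestorable c' n q` (through the landed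
  `orbitRestorationQP_iff_restorationOnVP`).  Families, `IsVPFamily` and the family-dependent constant disappear from the
  statement of stmt-18293: it is a statement about single invariant polynomials of polynomially bounded degree and
  complexity, with one orbit exponent per complexity exponent;
* `productDepthRestorationQP_iff_uniform` — the same for every rung `ProductDepthRestorationQP δ` with `δ ≥ 1`.

Honest label: reformulations (same strength); no stub is closed; VP ≠ VNP is not touched. [folklore]
-/

noncomputable section

open scoped Classical

-- `Summit.ValiantsHypothesis.ValiantsHypothesis.…` is the tree's single-conjunct layout (Sub = Summit).
set_option linter.dupNamespace false

namespace Summit.ValiantsHypothesis.ValiantsHypothesis.Theorems.OrbitRestorationQPDepthThreeRung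

namespace UniformForm

open Literature.Computability.AlgebraicComplexity MvPolynomial
open Summit.ValiantsHypothesis.ValiantsHypothesis.Theorems
open Summit.ValiantsHypothesis.ValiantsHypothesis.Theses.MonotoneRestoration

/-- **`RestorationOn 𝒞` ⟺ ITS UNIFORM LEVELWISE FORM**, for every levelwise class `𝒞` monotone in its exponent and
containing the constant polynomial `1` at some exponent.  (Diagonal argument as in `sigmaPiSigmaValue_iff_uniform`: bad
levels satisfy `c' < n! + 5` by `Restorable.qpOrbitRestorable_of_invariant`, fibres are finite, and the family of
fibre-maxima — `1` elsewhere — is matrix-symmetric and lies in the class with one exponent.) [folklore] -/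
theorem restorationOn_iff_uniform (𝒞 : (n : ℕ) → ℕ → MvPolynomial (Fin n × Fin n) ℂ → Prop)
    (hmono : ∀ (n c c' : ℕ) (q : MvPolynomial (Fin n × Fin n) ℂ), c ≤ c' → 𝒞 n c q → 𝒞 n c' q)
    (h1 : ∃ c₀ : ℕ, ∀ n : ℕ, 𝒞 n c₀ 1) :
    RestorationOn 𝒞 ↔
    (∀ c : ℕ, ∃ c' : ℕ, ∀ (n : ℕ) (q : MvPolynomial (Fin n × Fin n) ℂ),
        (∀ σ τ : Equiv.Perm (Fin n), MvPolynomial.rename (fun p : Fin n × Fin n => (σ p.1, τ p.2)) q = q) →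
        𝒞 n c q → QPOrbitRestorable c' n q) := by
  obtain ⟨c₀, hc₀⟩ := h1
  constructor
  · intro hA c
    by_contra hU
    push Not at hU
    have hBad : ∀ c' : ℕ, ∃ n : ℕ, ∃ q : MvPolynomial (Fin n × Fin n) ℂ,
        (∀ σ τ : Equiv.Perm (Fin n), MvPolynomial.rename (fun p : Fin n × Fin n => (σ p.1, τ p.2)) q = q) ∧
        𝒞 n c q ∧ ¬ QPOrbitRestorable c' n q := by
      intro c'
      obtain ⟨n, q, hs, hpd, hbad⟩ := hU c'
      exact ⟨n, q, hs, hpd, hbad⟩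
    choose nf hnf using hBad
    have hlt : ∀ c', c' < (nf c').factorial + 5 := by
      intro c'
      by_contra hle
      push Not at hle
      obtain ⟨q, hs, -, hbad⟩ := hnf c'
      exact hbad (Restorable.qpOrbitRestorable_mono hle
        (Restorable.qpOrbitRestorable_of_invariant q fun σ => ValueOrbit.ren_eq_of_matrixSymmetric hs σ))
    let fiber : ℕ → Finset ℕ := fun m => (Finset.range (m.factorial + 5)).filter fun c' => nf c' = m
    have hmem_fiber : ∀ c', c' ∈ fiber (nf c') := fun c' =>
      Finset.mem_filter.2 ⟨Finset.mem_range.2 (hlt c'), rfl⟩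
    have hfiber_level : ∀ {m c'}, c' ∈ fiber m → nf c' = m := fun h => (Finset.mem_filter.1 h).2
    have hBadAt : ∀ (m : ℕ) (h : (fiber m).Nonempty), ∃ q : MvPolynomial (Fin m × Fin m) ℂ,
        (∀ σ τ : Equiv.Perm (Fin m), MvPolynomial.rename (fun p : Fin m × Fin m => (σ p.1, τ p.2)) q = q) ∧
        𝒞 m c q ∧ ¬ QPOrbitRestorable ((fiber m).max' h) m q := by
      intro m h
      have hlev : nf ((fiber m).max' h) = m := hfiber_level (Finset.max'_mem _ h)
      have := hnf ((fiber m).max' h)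
      rw [hlev] at this
      exact this
    let f : (m : ℕ) → MvPolynomial (Fin m × Fin m) ℂ := fun m =>
      if h : (fiber m).Nonempty then Classical.choose (hBadAt m h) else 1
    have hf_pos : ∀ {m} (h : (fiber m).Nonempty), f m = Classical.choose (hBadAt m h) := fun h => by
      simp only [f, dif_pos h]
    have hf_neg : ∀ {m}, ¬ (fiber m).Nonempty → f m = 1 := fun h => by simp only [f, dif_neg h]
    have hsym : IsMatrixSymmetric f := by
      intro m σ τ
      by_cases h : (fiber m).Nonempty
      · rw [hf_pos h]; exact (Classical.choose_spec (hBadAt m h)).1 σ τ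
      · rw [hf_neg h, map_one]
    have hcl : ∃ c₁ : ℕ, ∀ m : ℕ, 𝒞 m c₁ (f m) := by
      refine ⟨max c c₀, fun m => ?_⟩
      by_cases h : (fiber m).Nonempty
      · rw [hf_pos h]
        exact hmono _ _ _ _ (le_max_left _ _) (Classical.choose_spec (hBadAt m h)).2.1
      · rw [hf_neg h]
        exact hmono _ _ _ _ (le_max_right _ _) (hc₀ m)
    obtain ⟨c₂, hc₂⟩ := hA f hsym hcl
    set m := nf c₂ with hm
    have hne : (fiber m).Nonempty := ⟨c₂, hmem_fiber c₂⟩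
    have hle : c₂ ≤ (fiber m).max' hne := Finset.le_max' _ _ (hmem_fiber c₂)
    have hres : QPOrbitRestorable ((fiber m).max' hne) m (Classical.choose (hBadAt m hne)) := by
      rw [← hf_pos hne]
      exact Restorable.qpOrbitRestorable_mono hle (hc₂ m)
    exact (Classical.choose_spec (hBadAt m hne)).2.2 hres
  · intro hU f hsym hpd
    obtain ⟨c, hc⟩ := hpd
    obtain ⟨c', hc'⟩ := hU c
    exact ⟨c', fun n => hc' n (f n) (hsym n) (hc n)⟩

/-- The constant `1` lies in `VPClass n 0`. [folklore] -/
theorem vpClass_one (n : ℕ) : VPClass n 0 (1 : MvPolynomial (Fin n × Fin n) ℂ) := by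
  refine ⟨by simp, ?_⟩
  have h : complexity (C (1 : ℂ) : MvPolynomial (Fin n × Fin n) ℂ) = 0 := complexity_C_holds 1
  rw [C_1] at h
  rw [h]
  exact Nat.zero_le _

/-- `VPClass` is monotone in the exponent. [folklore] -/
theorem vpClass_mono {n c c' : ℕ} {q : MvPolynomial (Fin n × Fin n) ℂ} (h : c ≤ c') (hq : VPClass n c q) :
    VPClass n c' q :=
  ⟨hq.1.trans (vsbr_pbound_mono h n), hq.2.trans (vsbr_pbound_mono h n)⟩

/-- **THE CRUX `OrbitRestorationQP` ⟺ ITS UNIFORM LEVELWISE FORM**: for every exponent `c` there is one constant `c'` such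
that every matrix-symmetric polynomial `q` on the `n × n` matrix with `deg q ≤ n^c + c` and `complexity q ≤ n^c + c` has a
square-symmetric circuit of orbit size `≤ 2^((log₂ n + c')^c')`.  No families, no `IsVPFamily`, no family-dependent
constant. [folklore] -/
theorem orbitRestorationQP_iff_uniform :
    OrbitRestorationQP ↔
    (∀ c : ℕ, ∃ c' : ℕ, ∀ (n : ℕ) (q : MvPolynomial (Fin n × Fin n) ℂ),
        (∀ σ τ : Equiv.Perm (Fin n), MvPolynomial.rename (fun p : Fin n × Fin n => (σ p.1, τ p.2)) q = q) →
        q.totalDegree ≤ n ^ c + c → complexity q ≤ n ^ c + c → QPOrbitRestorable c' n q) := by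
  rw [orbitRestorationQP_iff_restorationOnVP,
    restorationOn_iff_uniform VPClass (fun n c c' q h hq => vpClass_mono h hq) ⟨0, vpClass_one⟩]
  constructor
  · intro h c
    obtain ⟨c', hc'⟩ := h c
    exact ⟨c', fun n q hs hd hx => hc' n q hs ⟨hd, hx⟩⟩
  · intro h c
    obtain ⟨c', hc'⟩ := h c
    exact ⟨c', fun n q hs hq => hc' n q hs hq.1 hq.2⟩

/-- `PDClass` is monotone in the depth budget. [folklore] -/
theorem pdClass_mono_depth {δ δ' : ℕ → ℕ} (hδ : ∀ n, δ n ≤ δ' n) {n c : ℕ} {q : MvPolynomial (Fin n × Fin n) ℂ}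
    (h : PDClass δ n c q) : PDClass δ' n c q := by
  obtain ⟨hd, hc, P, hP, hΔ, hE⟩ := h
  exact ⟨hd, hc, P, hP, hΔ.trans (hδ n), hE⟩

/-- **Every rung `ProductDepthRestorationQP δ` (`δ ≥ 1`) ⟺ its uniform levelwise form.** [folklore] -/
theorem productDepthRestorationQP_iff_uniform (δ : ℕ → ℕ) (hδ : ∀ n, 1 ≤ δ n) :
    ProductDepthRestorationQP δ ↔
    (∀ c : ℕ, ∃ c' : ℕ, ∀ (n : ℕ) (q : MvPolynomial (Fin n × Fin n) ℂ),
        (∀ σ τ : Equiv.Perm (Fin n), MvPolynomial.rename (fun p : Fin n × Fin n => (σ p.1, τ p.2)) q = q) →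
        PDClass δ n c q → QPOrbitRestorable c' n q) :=
  restorationOn_iff_uniform (PDClass δ) (fun _ _ _ _ h hq => ExplicitForm.pdClass_mono_const h hq)
    ⟨8, fun n => pdClass_mono_depth hδ (pdClass_one_of_one n)⟩

end UniformForm

end Summit.ValiantsHypothesis.ValiantsHypothesis.Theorems.OrbitRestorationQPDepthThreeRung

end
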